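import Mathlib.Analysis.SpecialFunctions.Elliptic.Weierstrass
import Mathlib.NumberTheory.ModularForms.EisensteinSeries.Summable
import Literature.NumberTheory.EllipticCurves.RealLatticePeriod
import Literature.NumberTheory.EllipticCurves.TateCurve.LipschitzRows
import HarnessLib

/-!
# The `q`-expansion of the Weierstrass `℘`-function (Silverman, *Advanced Topics*, Prop. I.6.2 /
# Thm. V.1.1) — PROVED

Topic `Literature/NumberTheory/EllipticCurves/TateCurve`, namespace
`Literature.NumberTheory.EllipticCurves.TateCurve` (abc-iut cell, TRANCHE-T1 P21; sub-lemma U-1a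
of the discharge plan of the named fact `uniformization`: the complex input behind Tate's series
`X(u,q) = Σ_{n ∈ ℤ} qⁿu/(1 − qⁿu)² − 2s₁(q)`).

For `τ ∈ ℍ`, the lattice `Λ_τ = ℤτ + ℤ` (the tree's `ofUpperHalfPlane τ : PeriodPair`) and
`z ∈ ℂ` with `0 < Im z < Im τ`, writing `u = e^{2πiz}`, `q = e^{2πiτ}`, `T(t) = t/(1 − t)²`:

  `℘_{Λ_τ}(z) = (2πi)² · ( Σ_{n ∈ ℤ} T(qⁿu) + 1/12 − 2 Σ_{n ≥ 1} T(qⁿ) )`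

(`weierstrassP_ofUpperHalfPlane_eq`; Silverman ATAEC V §1, PDF p. 385:
"`(2πi)^{-2} ℘(u,q) = Σ_{n ∈ ℤ} qⁿu/(1 − qⁿu)² + 1/12 − 2s₁(q)`", with `s₁(q) = Σ_{n ≥ 1} qⁿ/(1−qⁿ)²`
by Remark V.1.2). Proof: `℘`'s lattice series (Mathlib `PeriodPair.hasSum_weierstrassP`, absolutely
convergent) is summed row by row along `ℤτ + ℤ ≃ ℤ × ℤ` (Mathlib `Summable.tsum_prod`), each row
being a Lipschitz sum `Σ_d (w + d)⁻² = (2πi)² T(e^{2πiw})` (`LipschitzRows.lean`: for `Im w ≠ 0`,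
which holds for `w = z − cτ` and `w = cτ`, `c ≠ 0`, under `0 < Im z < Im τ`), and the `c = 0` row
contributing the constant `−Σ_{d ≠ 0} d⁻² = −π²/3 = (2πi)²/12`.

## References
* [SilvermanATAEC1994] J. H. Silverman, *Advanced Topics in the Arithmetic of Elliptic Curves*,
  GTM 151, Springer 1994, Prop. I.6.2 and Ch. V §1, Thm. V.1.1 (PDF pp. 385–386).
-/

noncomputable section

open Complex Real Filter Topology
open UpperHalfPlane hiding I
open scoped PeriodPair

namespace Literature.NumberTheory.EllipticCurves.TateCurve

/-- `T(t) = t/(1 − t)²`, the summand of Tate's `X(u,q)` (junk `0` at `t = 1`).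
[cite: SilvermanATAEC1994, Thm. V.1.1 (PDF p. 386)] -/
def tFun (t : ℂ) : ℂ := t / (1 - t) ^ 2

/-- `T(t⁻¹) = T(t)`. [cite: SilvermanATAEC1994, Thm. V.3.1 (c) (proof, PDF p. 396)] -/
theorem tFun_inv (t : ℂ) : tFun t⁻¹ = tFun t := div_one_sub_sq_inv t

/-- `T(1) = 0` (Lean's junk value `x/0 = 0`). [folklore] -/
private theorem tFun_one : tFun 1 = 0 := by simp [tFun]

/-- The row sum `Σ_{d ∈ ℤ} (w + d)⁻² = (2πi)² T(e^{2πiw})` for `Im w ≠ 0` (`LipschitzRows`).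
[cite: SilvermanATAEC1994, Thm. V.1.1 (proof, PDF pp. 385–386)] -/
theorem tsum_int_one_div_add_sq_of_im_ne_zero {w : ℂ} (hw : w.im ≠ 0) :
    ∑' d : ℤ, 1 / (w + d) ^ 2 = (2 * π * I) ^ 2 * tFun (cexp (2 * π * I * w)) := by
  rcases lt_or_gt_of_ne hw with h | h
  · exact tsum_int_one_div_add_sq_of_im_neg h
  · exact tsum_int_one_div_add_sq ⟨w, h⟩

/-- The row sum with the opposite sign convention: `Σ_{d ∈ ℤ} (w − d)⁻² = (2πi)² T(e^{2πiw})`.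
[cite: SilvermanATAEC1994, Thm. V.1.1 (proof, PDF pp. 385–386)] -/
theorem tsum_int_one_div_sub_sq_of_im_ne_zero {w : ℂ} (hw : w.im ≠ 0) :
    ∑' d : ℤ, 1 / (w - d) ^ 2 = (2 * π * I) ^ 2 * tFun (cexp (2 * π * I * w)) := by
  rw [← tsum_int_one_div_add_sq_of_im_ne_zero hw, ← (Equiv.neg ℤ).tsum_eq]
  exact tsum_congr fun d ↦ by simp [sub_eq_add_neg]

/-- Summability of a row `d ↦ (w + d)⁻²` (Mathlib `EisensteinSeries.linear_right_summable`).
[folklore] -/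
private theorem summable_one_div_add_sq (w : ℂ) : Summable fun d : ℤ ↦ 1 / (w + d) ^ 2 := by
  have h := EisensteinSeries.linear_right_summable w 1 (k := 2) le_rfl
  refine h.congr fun d ↦ ?_
  simp [zpow_ofNat, one_div]

/-- Summability of a row `d ↦ (w − d)⁻²`. [folklore] -/
private theorem summable_one_div_sub_sq (w : ℂ) : Summable fun d : ℤ ↦ 1 / (w - d) ^ 2 := by
  have h := (summable_one_div_add_sq w).comp_injective (Equiv.neg ℤ).injective
  refine h.congr fun d ↦ ?_
  simp [sub_eq_add_neg]

/-- `‖T(t)‖ ≤ 4‖t‖` for `‖t‖ ≤ 1/2`. [folklore] -/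
private theorem norm_tFun_le {t : ℂ} (ht : ‖t‖ ≤ 1 / 2) : ‖tFun t‖ ≤ 4 * ‖t‖ := by
  rw [tFun, norm_div, norm_pow]
  have h1 : 1 / 2 ≤ ‖1 - t‖ := by
    have h := norm_sub_norm_le (1 : ℂ) t
    rw [norm_one] at h
    linarith
  have h2 : 1 / 4 ≤ ‖1 - t‖ ^ 2 := by nlinarith
  calc ‖t‖ / ‖1 - t‖ ^ 2 ≤ ‖t‖ / (1 / 4) :=
        div_le_div_of_nonneg_left (norm_nonneg _) (by norm_num) h2
    _ = 4 * ‖t‖ := by ring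

/-- `n ↦ T(qⁿ v)` is summable for `‖q‖ < 1` (eventually `‖qⁿv‖ ≤ 1/2`, then `‖T(qⁿv)‖ ≤ 4‖v‖‖q‖ⁿ`).
[folklore] -/
private theorem summable_tFun_pow_mul {q : ℂ} (hq : ‖q‖ < 1) (v : ℂ) :
    Summable fun n : ℕ ↦ tFun (q ^ n * v) := by
  have ht : Tendsto (fun n : ℕ ↦ ‖q ^ n * v‖) atTop (𝓝 0) := by
    have := ((tendsto_pow_atTop_nhds_zero_of_norm_lt_one hq).mul_const v).norm
    simpa using this
  obtain ⟨N, hN⟩ := eventually_atTop.mp (ht.eventually (Iic_mem_nhds (by norm_num : (0:ℝ) < 1/2)))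
  rw [← summable_nat_add_iff N]
  refine Summable.of_norm_bounded (g := fun n : ℕ ↦ 4 * (‖v‖ * ‖q‖ ^ N) * ‖q‖ ^ n) ?_ ?_
  · exact (summable_geometric_of_lt_one (norm_nonneg _) hq).mul_left _
  · intro n
    calc ‖tFun (q ^ (n + N) * v)‖ ≤ 4 * ‖q ^ (n + N) * v‖ := norm_tFun_le (hN _ (by omega))
      _ = 4 * (‖v‖ * ‖q‖ ^ N) * ‖q‖ ^ n := by rw [norm_mul, norm_pow, pow_add]; ring

/-- `c ↦ T(q^c v)` is summable over `ℤ` for `‖q‖ < 1` (`T(q^{-n}v) = T(qⁿv⁻¹)`): convergence of the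
series `X(u,q)` of Silverman ATAEC Thm. V.1.1 / V.3.1 (c) ("converge for all `u ∈ K̄`, `u ∉ q^ℤ`").
[cite: SilvermanATAEC1994, Thm. V.1.1 (PDF p. 386)] -/
theorem summable_tFun_zpow_mul {q : ℂ} (hq : ‖q‖ < 1) (v : ℂ) :
    Summable fun c : ℤ ↦ tFun (q ^ c * v) := by
  refine Summable.of_nat_of_neg ?_ ?_
  · simpa using summable_tFun_pow_mul hq v
  · have h := summable_tFun_pow_mul hq v⁻¹
    refine h.congr fun n ↦ ?_
    rw [← tFun_inv, zpow_neg, zpow_natCast, mul_inv, inv_inv]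

variable (τ : ℍ)

/-- `e^{2πi(cτ)} = q^c` for `c ∈ ℤ`, `q = e^{2πiτ}`. [folklore] -/
private theorem cexp_int_mul (c : ℤ) :
    cexp (2 * π * I * (c * (τ : ℂ))) = cexp (2 * π * I * τ) ^ c := by
  rw [← Complex.exp_int_mul]; ring_nf

set_option maxHeartbeats 400000 in
/-- **The `q`-expansion of `℘` (Silverman ATAEC Prop. I.6.2 / Thm. V.1.1), PROVED**: for
`τ ∈ ℍ` and `0 < Im z < Im τ`, with `u = e^{2πiz}`, `q = e^{2πiτ}`, `T(t) = t/(1−t)²`,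
`℘_{ℤτ+ℤ}(z) = (2πi)² (Σ_{n ∈ ℤ} T(qⁿu) + 1/12 − 2 Σ_{n ≥ 1} T(qⁿ))` — "`(2πi)^{-2}℘(u,q) =
Σ_{n∈ℤ} qⁿu/(1 − qⁿu)² + 1/12 − 2s₁(q)`" (PDF p. 385) with `s₁(q) = Σ_{n≥1} qⁿ/(1−qⁿ)²` (Remark
V.1.2). The series on the right are summable (`summable_tFun_zpow_mul`).
[cite: SilvermanATAEC1994, Thm. V.1.1 (PDF pp. 385–386)] -/
theorem weierstrassP_ofUpperHalfPlane_eq {z : ℂ} (hz0 : 0 < z.im) (hz1 : z.im < τ.im) :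
    ℘[PeriodPair.ofUpperHalfPlane τ] z = (2 * π * I) ^ 2 *
      (∑' n : ℤ, tFun (cexp (2 * π * I * τ) ^ n * cexp (2 * π * I * z)) + 1 / 12
        - 2 * ∑' n : ℕ, tFun (cexp (2 * π * I * τ) ^ (n + 1))) := by
  set L := PeriodPair.ofUpperHalfPlane τ with hL
  set q := cexp (2 * π * I * τ) with hq
  set u := cexp (2 * π * I * z) with hu
  -- `℘` as a sum over `ℤ × ℤ`
  set g : ℤ × ℤ → ℂ := fun p ↦ 1 / (z - (p.1 * (τ : ℂ) + p.2)) ^ 2 - 1 / (p.1 * (τ : ℂ) + p.2) ^ 2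
    with hg
  have hcoe : ∀ p : ℤ × ℤ, ((L.latticeEquivProd.symm.toEquiv p : L.lattice) : ℂ) =
      p.1 * (τ : ℂ) + p.2 := by
    intro p
    change ((L.latticeEquivProd.symm p : L.lattice) : ℂ) = _
    rw [PeriodPair.latticeEquiv_symm_apply]
    simp [hL]
  have hsum : HasSum g (℘[L] z) := by
    have h := L.hasSum_weierstrassP z
    rw [← (L.latticeEquivProd.symm.toEquiv).hasSum_iff] at h
    refine h.congr_fun fun p ↦ ?_
    simp only [hg, Function.comp_apply, hcoe]
  -- the imaginary parts of `z - cτ` and of `cτ` (`c ≠ 0`) are nonzero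
  have him : ∀ c : ℤ, (z - c * (τ : ℂ)).im ≠ 0 := by
    intro c hc
    simp only [Complex.sub_im, Complex.mul_im, Complex.intCast_re, UpperHalfPlane.coe_im,
      Complex.intCast_im, UpperHalfPlane.coe_re, zero_mul, add_zero] at hc
    -- `Im z = c · Im τ` with `0 < Im z < Im τ` is impossible for an integer `c`
    have hτ := τ.im_pos
    rcases le_or_gt c 0 with hc0 | hc0
    · have : (c : ℝ) * τ.im ≤ 0 := mul_nonpos_of_nonpos_of_nonneg (by exact_mod_cast hc0) hτ.le
      linarith
    · have hc1 : (1 : ℝ) ≤ c := by exact_mod_cast hc0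
      have : τ.im ≤ (c : ℝ) * τ.im := le_mul_of_one_le_left hτ.le hc1
      linarith
  have him' : ∀ c : ℤ, c ≠ 0 → ((c : ℂ) * (τ : ℂ)).im ≠ 0 := by
    intro c hc
    simp only [Complex.mul_im, Complex.intCast_re, UpperHalfPlane.coe_im, Complex.intCast_im,
      UpperHalfPlane.coe_re, zero_mul, add_zero]
    exact mul_ne_zero (by exact_mod_cast hc) τ.im_pos.ne'
  -- row sums
  have hrow : ∀ c : ℤ, ∑' d : ℤ, g (c, d) =
      (2 * π * I) ^ 2 * tFun (q ^ (-c) * u) -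
        (if c = 0 then (π : ℂ) ^ 2 / 3 else (2 * π * I) ^ 2 * tFun (q ^ c)) := by
    intro c
    have h1 : ∑' d : ℤ, 1 / (z - (c * (τ : ℂ) + d)) ^ 2 = (2 * π * I) ^ 2 * tFun (q ^ (-c) * u) := by
      have e : ∀ d : ℤ, z - (c * (τ : ℂ) + d) = (z - c * τ) - d := fun d ↦ by ring
      simp_rw [e]
      rw [tsum_int_one_div_sub_sq_of_im_ne_zero (him c)]
      congr 1
      have e2 : 2 * π * I * (z - c * (τ : ℂ)) = 2 * π * I * z + ((-c : ℤ) : ℂ) * (2 * π * I * τ) := by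
        push_cast; ring
      rw [hq, hu, e2, Complex.exp_add, Complex.exp_int_mul, mul_comm]
    have h2 : ∑' d : ℤ, 1 / ((c : ℂ) * (τ : ℂ) + d) ^ 2 =
        if c = 0 then (π : ℂ) ^ 2 / 3 else (2 * π * I) ^ 2 * tFun (q ^ c) := by
      split_ifs with hc
      · subst hc
        simpa using hasSum_int_one_div_sq.tsum_eq
      · rw [tsum_int_one_div_add_sq_of_im_ne_zero (him' c hc), hq, ← cexp_int_mul τ c]
    rw [show (fun d : ℤ ↦ g (c, d)) = fun d : ℤ ↦
        (1 / (z - (c * (τ : ℂ) + d)) ^ 2 - 1 / ((c : ℂ) * (τ : ℂ) + d) ^ 2) from rfl]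
    rw [Summable.tsum_sub, h1, h2]
    · have e : ∀ d : ℤ, z - (c * (τ : ℂ) + d) = (z - c * τ) - d := fun d ↦ by ring
      simp_rw [e]; exact summable_one_div_sub_sq _
    · exact summable_one_div_add_sq _
  -- sum the rows
  have hdouble : ℘[L] z = ∑' c : ℤ, ∑' d : ℤ, g (c, d) := by
    rw [← hsum.tsum_eq, hsum.summable.tsum_prod]
  have hrows : Summable fun c : ℤ ↦ ∑' d : ℤ, g (c, d) := hsum.summable.prod
  -- summability of `c ↦ T(q^c)` on `ℤ` (geometric both ways, `T(q^{-c}) = T(q^c)`)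
  have hq1 : ‖q‖ < 1 := norm_exp_two_pi_I_lt_one τ
  have hTq : Summable fun c : ℤ ↦ tFun (q ^ c) := by
    simpa using summable_tFun_zpow_mul hq1 1
  have hTu : Summable fun c : ℤ ↦ tFun (q ^ (-c) * u) := by
    have h := (summable_tFun_zpow_mul hq1 u).comp_injective (Equiv.neg ℤ).injective
    exact h.congr fun c ↦ by simp
  -- the second (constant) part of the rows, using `T(q⁰) = T(1) = 0`
  have hconst : ∀ c : ℤ, (if c = 0 then (π : ℂ) ^ 2 / 3 else (2 * π * I) ^ 2 * tFun (q ^ c)) =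
      (2 * π * I) ^ 2 * tFun (q ^ c) + if c = 0 then (π : ℂ) ^ 2 / 3 else 0 := by
    intro c
    split_ifs with hc
    · subst hc; simp [tFun_one]
    · simp
  have hind : HasSum (fun c : ℤ ↦ if c = 0 then (π : ℂ) ^ 2 / 3 else (0 : ℂ)) ((π : ℂ) ^ 2 / 3) :=
    hasSum_ite_eq 0 _
  have hrow' : ∀ c : ℤ, ∑' d : ℤ, g (c, d) =
      (2 * π * I) ^ 2 * tFun (q ^ (-c) * u) - (2 * π * I) ^ 2 * tFun (q ^ c)
        - (if c = 0 then (π : ℂ) ^ 2 / 3 else 0) := by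
    intro c; rw [hrow c, hconst c]; ring
  have htotal : HasSum (fun c : ℤ ↦ ∑' d : ℤ, g (c, d))
      ((2 * π * I) ^ 2 * ∑' c : ℤ, tFun (q ^ (-c) * u) - (2 * π * I) ^ 2 * ∑' c : ℤ, tFun (q ^ c)
        - (π : ℂ) ^ 2 / 3) := by
    simp_rw [hrow']
    exact ((hTu.hasSum.mul_left _).sub (hTq.hasSum.mul_left _)).sub hind
  rw [hdouble, htotal.tsum_eq]
  -- reindex: `Σ_c T(q^{-c}u) = Σ_n T(qⁿu)` and `Σ_{c ∈ ℤ} T(q^c) = 2 Σ_{n ≥ 1} T(qⁿ)`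
  have hre1 : ∑' c : ℤ, tFun (q ^ (-c) * u) = ∑' n : ℤ, tFun (q ^ n * u) := by
    rw [← (Equiv.neg ℤ).tsum_eq]; exact tsum_congr fun c ↦ by simp
  have hre2 : ∑' c : ℤ, tFun (q ^ c) = 2 * ∑' n : ℕ, tFun (q ^ (n + 1)) := by
    have h0 : Summable fun n : ℕ ↦ tFun (q ^ n) := by simpa using summable_tFun_pow_mul hq1 1
    have h1 : Summable fun n : ℕ ↦ tFun (q ^ (n + 1)) := (summable_nat_add_iff 1).mpr h0
    set S := ∑' n : ℕ, tFun (q ^ (n + 1)) with hS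
    have hA : HasSum (fun n : ℕ ↦ tFun (q ^ (n : ℤ))) S := by
      have e : ∑' n : ℕ, tFun (q ^ n) = S := by
        rw [h0.tsum_eq_zero_add, pow_zero, tFun_one, zero_add]
      have := h0.hasSum
      rw [e] at this
      exact this.congr_fun fun n ↦ by rw [zpow_natCast]
    have hB : HasSum (fun n : ℕ ↦ tFun (q ^ (-(n + 1 : ℤ)))) S := by
      refine h1.hasSum.congr_fun fun n ↦ ?_
      rw [zpow_neg, tFun_inv, show ((n : ℤ) + 1) = ((n + 1 : ℕ) : ℤ) by push_cast; rfl,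
        zpow_natCast]
    have := HasSum.of_nat_of_neg_add_one (f := fun c : ℤ ↦ tFun (q ^ c)) hA hB
    rw [this.tsum_eq]
    ring
  have hI : (2 * π * I : ℂ) ^ 2 = -4 * π ^ 2 := by
    rw [mul_pow, mul_pow, Complex.I_sq]; ring
  rw [hre1, hre2, hI]
  ring

end Literature.NumberTheory.EllipticCurves.TateCurve

end
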